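import Summits.PneNP.PneNP.Theorems.KrwChromaticSteeringStrongCompositionDefs

/-!
# Running exclusion (K1♯) typed family-wide, and the two monotonicity laws it rests on

Seat 2 · crux-ideate g3 for `stmt-PneNP-18538` (`KrwChromaticSteering.StrongComposition`), answering the
r1 triage asks "TYPE K1♯ as a `Prop` over `Family` / `chi` / `Aset` / `Bset`" (TRIAGE-r1-1 thrift-walk O1,
TRIAGE-r1-2 thrift-walk O2 / sharpen (a)).

* `BankAtLeast f F π s` — the two-currency bank at the bit string `π` is `≥ −s`:
  some live `g` whose residual label rectangle, together with `|π|` and `log₂ log₂ χ(G_π)`, certifies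
  `D(f) + n ≤ |π| + C_π(g) + log₂log₂ χ(G_π) + s` (written, as in `SteeredTranscript`, with `∀ R` solving
  the rectangle and `∃ Q` solving `f`, so no `sInf` junk values occur).
* `RunningExclusionK K` — the ∃-PATH form of K1♯ with an EXPLICIT constant: some bit string `λ` of
  length `≤ d` carries an x- or y-certificate with slack `K·L` at its end AND has bank `≥ −K·L` at every
  prefix.  `RunningExclusion := ∃ K, RunningExclusionK K`.  Refuters should attack `RunningExclusionK K`
  for small `K` at sizes with `K·L < n` (the `∃ K` absorbs every finite table).
* `steeredTranscript_of_runningExclusion` — RE ⟹ the route's lever (trivial: forget the prefixes).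
* `solvesOn_step` — the x-side ONE-BIT LAW (maxitivity of the residual rectangle of a fixed `g` along a
  family transcript): protocols for the two child rectangles at `π ++ [false]`, `π ++ [true]` give one for
  the rectangle at `π` of depth `≤ max + 1`; `xfloor_step` — hence the x-potential `|π| + C_π(g)` can be
  kept from dropping by choosing the next bit (for each fixed `g`).
* `chi_append_le` / `chi_le_chi_take` — `χ(G_π)` is antitone along extensions of `π`.

Nothing here proves K1♯; it makes it a statement.  P≠NP is not moved by this file.
-/

namespace Summit.PneNP.PneNP.Cruxes.StrongComposition.ThriftWalk

open Literature.Computability.Complexity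
open Summit.PneNP.PneNP.Theorems.KrwStrongComposition

/-! ### The typed statements -/

section Statements

variable {m n : ℕ}

/-- x-certificate at `π` with slack `s` (first disjunct of `SteeredTranscript`). -/
def XCert (f : (Fin m → Bool) → Bool) (F : Family m n) (π : List Bool) (s : ℕ) : Prop :=
  ∃ g ∈ Alive f F π, ∀ R : KWTree (Fin m), SolvesOn R (Aset f F π g) (Bset f F π g) →
    ∃ Q : KWTree (Fin m), Q.Solves f ∧ Q.depth + n ≤ π.length + R.depth + s

/-- y-certificate at `π` with slack `s` (second disjunct of `SteeredTranscript`). -/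
def YCert (f : (Fin m → Bool) → Bool) (F : Family m n) (π : List Bool) (s : ℕ) : Prop :=
  ∃ Q : KWTree (Fin m), Q.Solves f ∧
    Q.depth + n ≤ π.length + Nat.log 2 (Nat.log 2 (chi f F π)) + s

/-- BANK `≥ −s` at `π`: `D(f) + n ≤ |π| + C_π(g) + log₂log₂ χ(G_π) + s` for some live `g`. -/
def BankAtLeast (f : (Fin m → Bool) → Bool) (F : Family m n) (π : List Bool) (s : ℕ) : Prop :=
  ∃ g ∈ Alive f F π, ∀ R : KWTree (Fin m), SolvesOn R (Aset f F π g) (Bset f F π g) →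
    ∃ Q : KWTree (Fin m), Q.Solves f ∧
      Q.depth + n ≤ π.length + R.depth + Nat.log 2 (Nat.log 2 (chi f F π)) + s

end Statements

/-- RUNNING EXCLUSION with explicit constant `K` (K1♯, ∃-path form, family-wide). -/
def RunningExclusionK (K : ℕ) : Prop :=
  ∀ (m n : ℕ), 1 ≤ n → ∀ f : (Fin m → Bool) → Bool, (∃ a b, f a ≠ f b) →
    ∀ (F : Family m n) (d : ℕ), (∀ g, (F g).SolvesStrong f g) → (∀ g, (F g).depth ≤ d) →
      ∃ lam : List Bool, lam.length ≤ d ∧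
        (XCert f F lam (K * (Nat.log 2 (m * n) + 1)) ∨ YCert f F lam (K * (Nat.log 2 (m * n) + 1))) ∧
        ∀ t ≤ lam.length, BankAtLeast f F (lam.take t) (K * (Nat.log 2 (m * n) + 1))

/-- RUNNING EXCLUSION (K1♯): some constant works. -/
def RunningExclusion : Prop := ∃ K : ℕ, RunningExclusionK K

/-- RE ⟹ the route's lever `SteeredTranscript` (forget the prefix conditions). -/
theorem steeredTranscript_of_runningExclusion (h : RunningExclusion) : SteeredTranscript := by
  obtain ⟨K, hK⟩ := h
  refine ⟨K, fun m n hn f hf F d hS hd => ?_⟩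
  obtain ⟨lam, hlen, hcert, -⟩ := hK m n hn f hf F d hS hd
  exact ⟨lam, hlen, hcert⟩

/-! ### Reading one more bit: the node reached by `π` -/

section Step

universe u
variable {ι : Type u}

/-- The subtree reached by reading `π` from the root (a leaf, once reached, is kept). -/
def nodeAt : KWTree ι → List Bool → KWTree ι
  | T, [] => T
  | KWTree.leaf i, _ :: _ => KWTree.leaf i
  | KWTree.alice _ P _, false :: π => nodeAt P π
  | KWTree.alice _ _ Q, true :: π => nodeAt Q π
  | KWTree.bob _ P _, false :: π => nodeAt P π
  | KWTree.bob _ _ Q, true :: π => nodeAt Q π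

/-- Alice's test at the node reached by `π` (if that node is Alice's). -/
def aliceTestAt (T : KWTree ι) (π : List Bool) : Option ((ι → Bool) → Bool) :=
  match nodeAt T π with
  | KWTree.alice s _ _ => some s
  | _ => none

/-- Bob's test at the node reached by `π` (if that node is Bob's). -/
def bobTestAt (T : KWTree ι) (π : List Bool) : Option ((ι → Bool) → Bool) :=
  match nodeAt T π with
  | KWTree.bob s _ _ => some s
  | _ => none

theorem bobTestAt_eq_none_of_alice {T : KWTree ι} {π : List Bool} {s : (ι → Bool) → Bool}
    (h : aliceTestAt T π = some s) : bobTestAt T π = none := by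
  unfold aliceTestAt at h; unfold bobTestAt
  cases hN : nodeAt T π <;> simp_all

theorem aliceConsistent_append (T : KWTree ι) (x : ι → Bool) (π : List Bool) (β : Bool) :
    AliceConsistent T x (π ++ [β]) ↔
      AliceConsistent T x π ∧ ∀ s, aliceTestAt T π = some s → s x = β := by
  induction π generalizing T with
  | nil =>
      cases T <;> cases β <;> simp [AliceConsistent, aliceTestAt, nodeAt]
  | cons b π ih =>
      cases T <;> cases b <;> simp [AliceConsistent, aliceTestAt, nodeAt, ih, and_assoc]

theorem bobConsistent_append (T : KWTree ι) (y : ι → Bool) (π : List Bool) (β : Bool) :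
    BobConsistent T y (π ++ [β]) ↔
      BobConsistent T y π ∧ ∀ s, bobTestAt T π = some s → s y = β := by
  induction π generalizing T with
  | nil =>
      cases T <;> cases β <;> simp [BobConsistent, bobTestAt, nodeAt]
  | cons b π ih =>
      cases T <;> cases b <;> simp [BobConsistent, bobTestAt, nodeAt, ih, and_assoc]

theorem aliceConsistent_of_append (T : KWTree ι) (x : ι → Bool) (π τ : List Bool) :
    AliceConsistent T x (π ++ τ) → AliceConsistent T x π := by
  induction π generalizing T with
  | nil => intro; cases T <;> simp [AliceConsistent]
  | cons b π ih =>
      intro h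
      cases T with
      | leaf i => cases b <;> simp [AliceConsistent]
      | alice s P Q =>
          cases b <;> simp only [List.cons_append, AliceConsistent] at h ⊢
          · exact ⟨h.1, ih P h.2⟩
          · exact ⟨h.1, ih Q h.2⟩
      | bob s P Q =>
          cases b <;> simp only [List.cons_append, AliceConsistent] at h ⊢
          · exact ih P h
          · exact ih Q h

theorem bobConsistent_of_append (T : KWTree ι) (y : ι → Bool) (π τ : List Bool) :
    BobConsistent T y (π ++ τ) → BobConsistent T y π := by
  induction π generalizing T with
  | nil => intro; cases T <;> simp [BobConsistent]
  | cons b π ih =>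
      intro h
      cases T with
      | leaf i => cases b <;> simp [BobConsistent]
      | alice s P Q =>
          cases b <;> simp only [List.cons_append, BobConsistent] at h ⊢
          · exact ih P h
          · exact ih Q h
      | bob s P Q =>
          cases b <;> simp only [List.cons_append, BobConsistent] at h ⊢
          · exact ⟨h.1, ih P h.2⟩
          · exact ⟨h.1, ih Q h.2⟩

end Step

/-! ### Monotonicity of the transcript objects -/

section Mono

variable {m n : ℕ} (f : (Fin m → Bool) → Bool) (F : Family m n)

theorem xset_append_subset (π τ : List Bool) (g : (Fin n → Bool) → Bool) :
    Xset f F (π ++ τ) g ⊆ Xset f F π g := fun _ h =>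
  ⟨h.1, aliceConsistent_of_append _ _ _ _ h.2⟩

theorem yset_append_subset (π τ : List Bool) (g : (Fin n → Bool) → Bool) :
    Yset f F (π ++ τ) g ⊆ Yset f F π g := fun _ h =>
  ⟨h.1, bobConsistent_of_append _ _ _ _ h.2⟩

theorem aset_append_subset (π τ : List Bool) (g : (Fin n → Bool) → Bool) :
    Aset f F (π ++ τ) g ⊆ Aset f F π g :=
  Set.image_mono (xset_append_subset f F π τ g)

theorem bset_append_subset (π τ : List Bool) (g : (Fin n → Bool) → Bool) :
    Bset f F (π ++ τ) g ⊆ Bset f F π g :=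
  Set.image_mono (yset_append_subset f F π τ g)

theorem wip_of_append (π τ : List Bool) (gA gB : (Fin n → Bool) → Bool) :
    WIP f F (π ++ τ) gA gB → WIP f F π gA gB := by
  rintro ⟨X, hX, Y, hY, h⟩
  exact ⟨X, xset_append_subset f F π τ gA hX, Y, yset_append_subset f F π τ gB hY, h⟩

theorem charGraph_append_le (π τ : List Bool) : charGraph f F (π ++ τ) ≤ charGraph f F π := by
  intro gA gB h
  exact ⟨h.1, h.2.imp (wip_of_append f F π τ gA gB) (wip_of_append f F π τ gB gA)⟩

/-- `χ` is antitone along extensions of the bit string. -/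
theorem chi_append_le (π τ : List Bool) : chi f F (π ++ τ) ≤ chi f F π := by
  unfold chi
  apply ENat.toNat_le_toNat
  · exact SimpleGraph.chromaticNumber_mono _ (charGraph_append_le f F π τ)
  · exact SimpleGraph.chromaticNumber_ne_top_iff_exists.2 ⟨_, SimpleGraph.colorable_of_fintype _⟩

theorem chi_le_chi_take (π : List Bool) (t : ℕ) : chi f F π ≤ chi f F (π.take t) := by
  have h := chi_append_le f F (π.take t) (π.drop t)
  rwa [List.take_append_drop] at h

/-! ### The x-side one-bit law (maxitivity of the residual rectangle) -/

theorem xset_append_bit (π : List Bool) (β : Bool) (g : (Fin n → Bool) → Bool) :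
    Xset f F (π ++ [β]) g = {X | X ∈ Xset f F π g ∧ ∀ s, aliceTestAt (F g) π = some s → s X = β} := by
  ext X
  simp only [Xset, Set.mem_setOf_eq, aliceConsistent_append, and_assoc]

theorem yset_append_bit (π : List Bool) (β : Bool) (g : (Fin n → Bool) → Bool) :
    Yset f F (π ++ [β]) g = {Y | Y ∈ Yset f F π g ∧ ∀ s, bobTestAt (F g) π = some s → s Y = β} := by
  ext Y
  simp only [Yset, Set.mem_setOf_eq, bobConsistent_append, and_assoc]

/-- The two child label sets cover the parent: every `a ∈ 𝒜_π(g)` lies in `𝒜_{π0}(g)` or `𝒜_{π1}(g)`. -/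
theorem aset_subset_union (π : List Bool) (g : (Fin n → Bool) → Bool) :
    Aset f F π g ⊆ Aset f F (π ++ [false]) g ∪ Aset f F (π ++ [true]) g := by
  rintro a ⟨X, hX, rfl⟩
  cases hA : aliceTestAt (F g) π with
  | none =>
      left; refine ⟨X, ?_, rfl⟩
      rw [xset_append_bit]; exact ⟨hX, fun s hs => by simp [hA] at hs⟩
  | some s =>
      cases hs : s X with
      | false =>
          left; refine ⟨X, ?_, rfl⟩
          rw [xset_append_bit]; exact ⟨hX, fun s' hs' => by simp_all⟩
      | true =>
          right; refine ⟨X, ?_, rfl⟩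
          rw [xset_append_bit]; exact ⟨hX, fun s' hs' => by simp_all⟩

theorem bset_subset_union (π : List Bool) (g : (Fin n → Bool) → Bool) :
    Bset f F π g ⊆ Bset f F (π ++ [false]) g ∪ Bset f F (π ++ [true]) g := by
  rintro b ⟨Y, hY, rfl⟩
  cases hB : bobTestAt (F g) π with
  | none =>
      left; refine ⟨Y, ?_, rfl⟩
      rw [yset_append_bit]; exact ⟨hY, fun s hs => by simp [hB] at hs⟩
  | some s =>
      cases hs : s Y with
      | false =>
          left; refine ⟨Y, ?_, rfl⟩
          rw [yset_append_bit]; exact ⟨hY, fun s' hs' => by simp_all⟩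
      | true =>
          right; refine ⟨Y, ?_, rfl⟩
          rw [yset_append_bit]; exact ⟨hY, fun s' hs' => by simp_all⟩

/-- If the node reached is not Bob's, Bob's label set does not change on reading one more bit. -/
theorem bset_append_bit_of_none (π : List Bool) (β : Bool) (g : (Fin n → Bool) → Bool)
    (h : bobTestAt (F g) π = none) : Bset f F (π ++ [β]) g = Bset f F π g := by
  apply Set.Subset.antisymm (bset_append_subset f F π [β] g)
  rintro b ⟨Y, hY, rfl⟩
  refine ⟨Y, ?_, rfl⟩
  rw [yset_append_bit]; exact ⟨hY, fun s hs => by simp [h] at hs⟩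

/-- If the node reached is not Alice's, Alice's label set does not change on reading one more bit. -/
theorem aset_append_bit_of_none (π : List Bool) (β : Bool) (g : (Fin n → Bool) → Bool)
    (h : aliceTestAt (F g) π = none) : Aset f F (π ++ [β]) g = Aset f F π g := by
  apply Set.Subset.antisymm (aset_append_subset f F π [β] g)
  rintro a ⟨X, hX, rfl⟩
  refine ⟨X, ?_, rfl⟩
  rw [xset_append_bit]; exact ⟨hX, fun s hs => by simp [h] at hs⟩

/-- THE x-SIDE ONE-BIT LAW (maxitivity): protocols for the residual rectangles of `g` at the two
one-bit extensions of `π` combine into one for the rectangle at `π`, one level deeper. -/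
theorem solvesOn_step (π : List Bool) (g : (Fin n → Bool) → Bool) (R₀ R₁ : KWTree (Fin m))
    (h₀ : SolvesOn R₀ (Aset f F (π ++ [false]) g) (Bset f F (π ++ [false]) g))
    (h₁ : SolvesOn R₁ (Aset f F (π ++ [true]) g) (Bset f F (π ++ [true]) g)) :
    ∃ R : KWTree (Fin m), SolvesOn R (Aset f F π g) (Bset f F π g) ∧
      R.depth ≤ max R₀.depth R₁.depth + 1 := by
  classical
  cases hA : aliceTestAt (F g) π with
  | some s =>
      -- Alice speaks at the node: Bob's label set is unchanged in both children.
      have hB := bobTestAt_eq_none_of_alice hA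
      have hB0 := bset_append_bit_of_none f F π false g hB
      have hB1 := bset_append_bit_of_none f F π true g hB
      refine ⟨KWTree.alice (fun a => decide (a ∈ Aset f F (π ++ [true]) g)) R₀ R₁, ?_, by simp⟩
      intro a ha b hb
      by_cases h1 : a ∈ Aset f F (π ++ [true]) g
      · have := h₁ a h1 b (hB1 ▸ hb)
        simpa [KWTree.run, h1] using this
      · have h0 : a ∈ Aset f F (π ++ [false]) g := by
          rcases aset_subset_union f F π g ha with h | h
          · exact h
          · exact absurd h h1
        have := h₀ a h0 b (hB0 ▸ hb)
        simpa [KWTree.run, h1] using this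
  | none =>
      have hA0 := aset_append_bit_of_none f F π false g hA
      have hA1 := aset_append_bit_of_none f F π true g hA
      cases hB : bobTestAt (F g) π with
      | some s =>
          refine ⟨KWTree.bob (fun b => decide (b ∈ Bset f F (π ++ [true]) g)) R₀ R₁, ?_, by simp⟩
          intro a ha b hb
          by_cases h1 : b ∈ Bset f F (π ++ [true]) g
          · have := h₁ a (hA1 ▸ ha) b h1
            simpa [KWTree.run, h1] using this
          · have h0 : b ∈ Bset f F (π ++ [false]) g := by
              rcases bset_subset_union f F π g hb with h | h
              · exact h
              · exact absurd h h1
            have := h₀ a (hA0 ▸ ha) b h0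
            simpa [KWTree.run, h1] using this
      | none =>
          -- a leaf was reached: nothing changes; reuse `R₀`.
          have hB0 := bset_append_bit_of_none f F π false g hB
          refine ⟨R₀, ?_, by omega⟩
          intro a ha b hb
          exact h₀ a (hA0 ▸ ha) b (hB0 ▸ hb)

/-- x-FLOOR STEP: if at `π` every residual protocol `R` of `g` certifies `D(f) + n ≤ |π| + depth R + s`,
then the same holds at one of the two one-bit extensions (with `|π| + 1`).  Iterating from any node keeps
the x-potential `|π| + C_π(g)` from dropping — the "thrift" half of the bank. -/
theorem xfloor_step (π : List Bool) (g : (Fin n → Bool) → Bool) (s : ℕ)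
    (hQ : ∀ R : KWTree (Fin m), SolvesOn R (Aset f F π g) (Bset f F π g) →
      ∃ Q : KWTree (Fin m), Q.Solves f ∧ Q.depth + n ≤ π.length + R.depth + s) :
    ∃ β : Bool, ∀ R' : KWTree (Fin m), SolvesOn R' (Aset f F (π ++ [β]) g) (Bset f F (π ++ [β]) g) →
      ∃ Q : KWTree (Fin m), Q.Solves f ∧ Q.depth + n ≤ (π ++ [β]).length + R'.depth + s := by
  by_contra h
  push Not at h
  obtain ⟨R₀, hR₀, hQ₀⟩ := h false
  obtain ⟨R₁, hR₁, hQ₁⟩ := h true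
  obtain ⟨R, hR, hdep⟩ := solvesOn_step f F π g R₀ R₁ hR₀ hR₁
  obtain ⟨Q, hQs, hQd⟩ := hQ R hR
  have e₀ := hQ₀ Q hQs
  have e₁ := hQ₁ Q hQs
  simp only [List.length_append, List.length_singleton] at e₀ e₁
  rcases Nat.le_total R₀.depth R₁.depth with hle | hle
  · rw [max_eq_right hle] at hdep; omega
  · rw [max_eq_left hle] at hdep; omega

end Mono

end Summit.PneNP.PneNP.Cruxes.StrongComposition.ThriftWalk
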